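import Summits.QuantumFields.YangMills.Theses.ThermalTraceWindow
import Summits.QuantumFields.YangMills.Theorems.LuscherReductionRunningReductionTraceFormula
import Summits.QuantumFields.YangMills.Theorems.LuscherReductionRunningReductionUniformFloor
import Summits.QuantumFields.YangMills.Theorems.LuscherReductionRunningReductionCoarseUpperCopies
import Summits.QuantumFields.YangMills.Theorems.FemtoTransferGapLevelsDecay
import HarnessLib

/-!
# `ThermalTraceWindow.FewBodyEntropy` — FIRST RUNG at every fixed lattice size (BC5 witness for K1a, item stmt-QuantumFields-22537)

K1a (`FewBodyEntropy`) asks `Z_phys(L×L³) ≤ (1 + C β^q L^p √((λ₁/λ₀)^L)) λ₀^L` with `C, q, p` UNIFORM in `β` and `L`.  Its femto-regime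
content at a FIXED lattice size `L ≥ 2` is «the zero-flux thermal entropy of the 4-torus `L×L³` is polynomial in `β`», and that much is
proved here, for every `L ≥ 2` and every `β ≥ 1`:

* `physTrace_le_poly_mul_levelValue_zero_pow` — `Z_phys(L×L³) ≤ C_L · β^{12L³} · λ₀(β,L)^L` with `C_L = ((4/w₀)^{3L³}/c_L)²`
  (`w₀ = e^{−1/2}·8/(3π³)`, `c_L = uniformFloorConst L`).

Mechanism (three tree facts and the PROVED trace formula): `Σ_k λ_k^L = Z_phys(L)` (`TT.traceFormula_all`) and `0 ≤ λ_k ≤ λ₀` give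
`Z_phys(L) ≤ λ₀^{L−2} Σ_k λ_k²`; Hilbert–Schmidt (`sum_levelValue_sq_le`) gives `Σ_k λ_k² ≤ M²` for the pointwise kernel bound
`M = e^{2β|E|}` (`transferKernel_le_latE`, `latE_le`); the β-UNIFORM FLOOR `λ₀ ≥ c_L · c_β^{|E|}` (`levelValue_zero_ge_uniform`) with
`c_β ≥ e^{2β} w₀/(4β²)` (`linkC_ge_poly`) gives `M ≤ ((4/w₀)^{|E|}/c_L) · β^{2|E|} · λ₀`, `|E| = 3L³`.

HONEST FRAMING: the exponent `12L³` grows with `L` — K1a proper wants exponents uniform in `L` together with the first-level factor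
`√((λ₁/λ₀)^L)`; this rung is the fixed-lattice shadow only (outside any regime where R2ξ″ or the mass gap is known, and it exercises the
route's lever: trace formula + transfer-operator floor).  Fixed-lattice functional analysis; no RG content; no summit.
-/

noncomputable section

open MeasureTheory Filter Topology Real
open Literature.MathematicalPhysics.QuantumLattice
open Literature.MathematicalPhysics.QuantumFieldTheory hiding SU2
open Summit.QuantumFields.YangMills.Theorems
open Summit.QuantumFields.YangMills.Theorems.FemtoTransferGap

namespace Summit.QuantumFields.YangMills.Theses.ThermalTraceWindow

/-- **Pointwise kernel bound against the top value**: `K_β(U,V) ≤ ((4/w₀)^{|E|}/c_L) · β^{2|E|} · λ₀(β,L)` for `β ≥ 1`.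
[cite: Luscher1983, §2] -/
theorem transferKernel_le_poly_mul_levelValue_zero (L : ℕ) [NeZero L] {β : ℝ} (hβ : 1 ≤ β) (U V : GaugeConfig 3 L FemtoTransferGap.SU2) :
    transferKernel su2Rep β U V ≤
      ((4 / (Real.exp (-(1 / 2 : ℝ)) * (8 / (3 * π ^ 3)))) ^ Fintype.card (Edge 3 L) / uniformFloorConst L) *
        β ^ (2 * Fintype.card (Edge 3 L)) * levelValue su2Rep L β 0 := by
  have hβ0 : 0 < β := by linarith
  set E : ℕ := Fintype.card (Edge 3 L) with hE
  set w₀ : ℝ := Real.exp (-(1 / 2 : ℝ)) * (8 / (3 * π ^ 3)) with hw₀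
  have hw : 0 < w₀ := by positivity
  have hcL : 0 < uniformFloorConst L := uniformFloorConst_pos
  -- `K ≤ e^{2β}^E`
  have hK : transferKernel su2Rep β U V ≤ Real.exp (2 * β) ^ E :=
    (transferKernel_le_latE hβ0.le U V).trans (latE_le hβ0.le U V)
  -- `c_L · (e^{2β} · w₀/(4β²))^E ≤ λ₀`
  have hlink : Real.exp (2 * β) * (w₀ / (4 * β ^ 2)) ≤ linkC β := linkC_ge_poly hβ
  have hlink0 : 0 ≤ Real.exp (2 * β) * (w₀ / (4 * β ^ 2)) := by positivity
  have hlat : (Real.exp (2 * β) * (w₀ / (4 * β ^ 2))) ^ E ≤ latCE L β := pow_le_pow_left₀ hlink0 hlink E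
  have hfloor : uniformFloorConst L * (Real.exp (2 * β) * (w₀ / (4 * β ^ 2))) ^ E ≤ levelValue su2Rep L β 0 :=
    (mul_le_mul_of_nonneg_left hlat hcL.le).trans (levelValue_zero_ge_uniform hβ)
  -- the algebra: `e^{2β}^E = ((4/w₀)^E/c_L) · β^{2E} · (c_L · (e^{2β} w₀/(4β²))^E)`
  have hid : Real.exp (2 * β) ^ E =
      ((4 / w₀) ^ E / uniformFloorConst L) * β ^ (2 * E) *
        (uniformFloorConst L * (Real.exp (2 * β) * (w₀ / (4 * β ^ 2))) ^ E) := by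
    have h1 : ((4 / w₀) ^ E / uniformFloorConst L) * β ^ (2 * E) *
        (uniformFloorConst L * (Real.exp (2 * β) * (w₀ / (4 * β ^ 2))) ^ E) =
          ((4 / w₀) * β ^ 2 * (w₀ / (4 * β ^ 2))) ^ E * Real.exp (2 * β) ^ E := by
      rw [pow_mul, mul_pow, mul_pow, mul_pow]
      field_simp
    have h2 : (4 / w₀) * β ^ 2 * (w₀ / (4 * β ^ 2)) = 1 := by
      field_simp
    rw [h1, h2, one_pow, one_mul]
  calc transferKernel su2Rep β U V ≤ Real.exp (2 * β) ^ E := hK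
    _ = ((4 / w₀) ^ E / uniformFloorConst L) * β ^ (2 * E) *
        (uniformFloorConst L * (Real.exp (2 * β) * (w₀ / (4 * β ^ 2))) ^ E) := hid
    _ ≤ ((4 / w₀) ^ E / uniformFloorConst L) * β ^ (2 * E) * levelValue su2Rep L β 0 :=
        mul_le_mul_of_nonneg_left hfloor (by positivity)

/-- **FIXED-LATTICE FEW-BODY ENTROPY** (first rung of `FewBodyEntropy`, item stmt-QuantumFields-22537): for every `L ≥ 2` there are
`C, q` (`C = ((4/w₀)^{3L³}/c_L)²`, `q = 4|E| = 12L³`) with `Z_phys(L×L³) ≤ C β^q λ₀(β,L)^L` for all `β ≥ 1` — the zero-flux thermal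
entropy `Σ_{k≥1}(λ_k/λ₀)^L` of the 4-torus is at most polynomial in `β` at fixed lattice size.
[cite: Luscher1983, §2] [cite: MontvayMunster1994, (3.145)] [cite: ReedSimonI1980, Thm. VI.22] -/
theorem physTrace_le_poly_mul_levelValue_zero_pow (L : ℕ) [NeZero L] (hL : 2 ≤ L) :
    ∃ C q : ℝ, 0 < C ∧ ∀ β : ℝ, 1 ≤ β → TT.physTrace L β L ≤ C * β ^ q * levelValue su2Rep L β 0 ^ L := by
  set E : ℕ := Fintype.card (Edge 3 L) with hE
  set K : ℝ := (4 / (Real.exp (-(1 / 2 : ℝ)) * (8 / (3 * π ^ 3)))) ^ E / uniformFloorConst L with hK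
  have hcL : 0 < uniformFloorConst L := uniformFloorConst_pos
  have hKpos : 0 < K := by positivity
  refine ⟨K ^ 2, ((4 * E : ℕ) : ℝ), by positivity, fun β hβ => ?_⟩
  have hβ0 : 0 < β := by linarith
  rw [Real.rpow_natCast]
  set lam0 : ℝ := levelValue su2Rep L β 0 with hlam0
  have hl0 : 0 < lam0 := levelValue_zero_su2Rep_pos L β
  -- pointwise kernel bound `K_β ≤ M := K β^{2E} λ₀`
  set M : ℝ := K * β ^ (2 * E) * lam0 with hM
  have hKM : ∀ U V : GaugeConfig 3 L FemtoTransferGap.SU2, transferKernel su2Rep β U V ≤ M := fun U V =>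
    transferKernel_le_poly_mul_levelValue_zero L hβ U V
  -- Hilbert–Schmidt: partial sums of `λ_k²` are `≤ M²`
  have hHS : ∀ k : ℕ, ∑ j ∈ Finset.range (k + 1), levelValue su2Rep L β j ^ 2 ≤ M ^ 2 := fun k => by
    rw [Finset.sum_range]
    exact sum_levelValue_sq_le (L := L) hβ0 hKM k
  -- termwise `λ_k^L ≤ λ₀^{L-2} λ_k²`
  have hterm : ∀ k : ℕ, levelValue su2Rep L β k ^ L ≤ lam0 ^ (L - 2) * levelValue su2Rep L β k ^ 2 := fun k => by
    have hk0 : 0 ≤ levelValue su2Rep L β k := (levelValue_su2Rep_pos hβ0 k).le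
    have hk : levelValue su2Rep L β k ≤ lam0 := levelValue_le_of_le hβ0 (Nat.zero_le k)
    have hsplit : levelValue su2Rep L β k ^ L = levelValue su2Rep L β k ^ (L - 2) * levelValue su2Rep L β k ^ 2 := by
      rw [← pow_add]; congr 1; omega
    rw [hsplit]
    exact mul_le_mul_of_nonneg_right (pow_le_pow_left₀ hk0 hk _) (sq_nonneg _)
  -- every finite partial sum of `λ_k^L` is `≤ λ₀^{L-2} M²`
  have hS := TT.traceFormula_all L β L hβ hL
  have hbound : ∀ s : Finset ℕ, ∑ k ∈ s, levelValue su2Rep L β k ^ L ≤ lam0 ^ (L - 2) * M ^ 2 := fun s => by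
    have hsub : s ⊆ Finset.range (s.sup id + 1) := fun i hi =>
      Finset.mem_range.2 (Nat.lt_succ_of_le (Finset.le_sup (f := id) hi))
    calc ∑ k ∈ s, levelValue su2Rep L β k ^ L ≤ ∑ k ∈ s, lam0 ^ (L - 2) * levelValue su2Rep L β k ^ 2 :=
          Finset.sum_le_sum fun k _ => hterm k
      _ ≤ ∑ k ∈ Finset.range (s.sup id + 1), lam0 ^ (L - 2) * levelValue su2Rep L β k ^ 2 :=
          Finset.sum_le_sum_of_subset_of_nonneg hsub fun k _ _ => by positivity
      _ = lam0 ^ (L - 2) * ∑ k ∈ Finset.range (s.sup id + 1), levelValue su2Rep L β k ^ 2 := by rw [Finset.mul_sum]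
      _ ≤ lam0 ^ (L - 2) * M ^ 2 := mul_le_mul_of_nonneg_left (hHS _) (pow_nonneg hl0.le _)
  have hZ : TT.physTrace L β L ≤ lam0 ^ (L - 2) * M ^ 2 := hasSum_le_of_sum_le hS hbound
  -- `λ₀^{L-2} M² = K² β^{4E} λ₀^L`
  have hfin : lam0 ^ (L - 2) * M ^ 2 = K ^ 2 * β ^ (4 * E) * lam0 ^ L := by
    rw [hM]
    have hL2 : L = (L - 2) + 2 := by omega
    conv_rhs => rw [hL2]
    rw [pow_add, show 4 * E = 2 * (2 * E) from by ring, pow_mul]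
    ring
  exact hZ.trans_eq hfin

end Summit.QuantumFields.YangMills.Theses.ThermalTraceWindow

end
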